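import Summits.HodgeConjecture.HodgeConjecture.Theorems.CurveNetMordellWeilVerticalSupportMiddleChowDegenerate
import Summits.HodgeConjecture.HodgeConjecture.Theorems.CurveNetMordellWeilVerticalSupportMiddleIffHodge
import Summits.HodgeConjecture.HodgeConjecture.Theorems.CurveNetMordellWeilVerticalSupportMiddleLevelSplit
import Literature.AlgebraicGeometry.HodgeTheory.ComplexOrientationDegreeFormulaHolds

/-!
# Route CurveNetMordellWeil — `VerticalSupportMiddle`: the CH₀-degenerate regime is a THEOREM

Line `regime-split-middle-step` of the crux `VerticalSupportMiddle` (stmt-HodgeConjecture-2782), lead c2,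
wave 3 (2026-08-17). The two named facts behind the Gysin / cycle-class formalism of the line's
CH₀-degenerate regime are now theorems of the tree —
`Fulton1998_degreeFormula_complexOrientation_holds` and `topHodgeClasses_spanned_by_pullbacks_holds`
(whence `Voisin2003_cycleClass_div_eq_zero_complexOrientation_holds`) — so every statement the line proved
"granted `(G, hG)`" or "modulo the two facts" becomes unconditional:

* `middleStepChowDegenerate_holds` — **the middle step of the Hodge conjecture on CH₀-degenerate
  `2q`-folds** (`q ≥ 2`, given HC below): Bloch–Srinivas decomposition of the diagonal + Voisin II Prop. 10.26;
* `hodgeFourfoldsChowDegenerate_holds` — **HC(4;2,2) for every smooth projective complex fourfold with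
  degenerate CH₀** (⊇ uniruled, rationally connected: Conte–Murre), unconditionally (the induction
  hypothesis `hodgeBelowDim_four` being a theorem); `hodgeConjectureFor_of_chowZeroDegenerate_fourfold` —
  the full Hodge conjecture for such fourfolds;
* `middleStepFor_chowRankLEOne_holds` — the middle step on `2q`-folds with `CH₀ ⊗ ℚ` of rank `≤ 1`;
* `hodgeConjecture_iff_heart`, `verticalSupportMiddle_iff_heart` — **the Hodge conjecture, and the crux, are
  EQUIVALENT to the line's heart** `MiddleStepFor (¬ ChowZeroDegenerate ·)` (HC in the middle degree for
  CH₀-non-degenerate `2q`-folds, given HC below), by theorem and without hypotheses: the registered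
  skeleton's single remaining stub is crux-sized.

## References

* [BlochSrinivas1983] S. Bloch, V. Srinivas, Remarks on correspondences and algebraic cycles, Amer. J.
  Math. 105 (1983), Thm. 1.
* [VoisinHodgeII2003] C. Voisin, Hodge Theory and Complex Algebraic Geometry II, Lemma 9.18, Cor. 10.21,
  Thm. 10.17, Prop. 10.26.
* [ConteMurre1978] A. Conte, J. P. Murre, The Hodge conjecture for fourfolds admitting a covering by
  rational curves, Math. Ann. 238 (1978).
* [Fulton1998] W. Fulton, Intersection Theory, 2nd ed., Lemma 19.1.2.
-/

noncomputable section

-- `Summit.HodgeConjecture.HodgeConjecture.Theorems` is the mandated namespace (single-problem summit),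
-- flagged by `linter.dupNamespace`; the lakefile turns the linter off tree-wide, restated for stand-alone runs.
set_option linter.dupNamespace false

open CategoryTheory AlgebraicGeometry
open Literature.AlgebraicGeometry Literature.AlgebraicGeometry.Motives Literature.AlgebraicGeometry.HodgeTheory
open Summit.HodgeConjecture.HodgeConjecture.Theorems.RegimeSplit

namespace Summit.HodgeConjecture.HodgeConjecture.Theorems

/-- **The CH₀-degenerate regime of the middle step is a theorem**: for `q ≥ 2` and `X` smooth projective of
dimension `2q` with `CH₀(X)` degenerate, the Hodge conjecture in dimensions `< 2q` implies that every
rational `(q,q)`-class on `X` is algebraic — `middleStepChowDegenerate_of_degreeFormula_of_spanning` with both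
named facts discharged (`Fulton1998_degreeFormula_complexOrientation_holds`,
`topHodgeClasses_spanned_by_pullbacks_holds`). [cite: BlochSrinivas1983, Thm. 1]
[cite: VoisinHodgeII2003, Prop. 10.26] [cite: Fulton1998, Lemma 19.1.2] -/
theorem middleStepChowDegenerate_holds : MiddleStepFor ChowZeroDegenerate :=
  middleStepChowDegenerate_of_degreeFormula_of_spanning Fulton1998_degreeFormula_complexOrientation_holds
    topHodgeClasses_spanned_by_pullbacks_holds

/-- **HC(4;2,2) for CH₀-degenerate fourfolds, unconditionally**: on a smooth projective complex fourfold
whose `0`-cycles are all rationally equivalent to `0`-cycles supported on a proper closed subset (e.g. a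
uniruled or rationally connected fourfold), every rational `(2,2)`-class is algebraic (the induction
hypothesis `hodgeBelowDim_four` is a theorem). Piece P₁ `HodgeFourfoldsChowDegenerate` of the strategist's
split. [cite: ConteMurre1978] [cite: VoisinHodgeII2003, Prop. 10.26] -/
theorem hodgeFourfoldsChowDegenerate_holds :
    ∀ ⦃X : SchemeOver ℂ⦄, IsSmoothProjective 4 X → ChowZeroDegenerate X →
      ∀ c : complexBetti X (2 * 2), IsRationalClass c → IsOfHodgeType 4 X (2 * 2) 2 2 c → c ∈ algebraicClasses X 2 :=
  hodgeFourfoldsChowDegenerate_of_degreeFormula Fulton1998_degreeFormula_complexOrientation_holds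

/-- **The Hodge conjecture for CH₀-degenerate fourfolds** (all degrees), unconditionally.
[cite: ConteMurre1978] [cite: VoisinHodgeII2003, Prop. 10.26] -/
theorem hodgeConjectureFor_of_chowZeroDegenerate_fourfold {X : SchemeOver ℂ} (hX : IsSmoothProjective 4 X)
    (hW : ChowZeroDegenerate X) : HodgeConjectureFor 4 X := by
  obtain ⟨G, hG⟩ := exists_gysinFormalism_isGysinHodgeCompatible_complexOrientation_holds
  exact hodgeConjectureFor_of_chowZeroDegenerate_fourfold_of_gysin G hG hX hW

/-- **The middle step on `2q`-folds with `CH₀ ⊗ ℚ` of rank `≤ 1`, unconditionally** (`middleStepFor_chowRankLEOne_of_gysin`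
needs ANY Gysin / cycle-class formalism, and one exists): cubic / quartic / quintic and all rationally connected `2q`-folds,
given the Chow-theoretic input and HC below. [cite: BlochSrinivas1983, Thm. 1] [cite: VoisinHodgeII2003, Prop. 10.26] -/
theorem middleStepFor_chowRankLEOne_holds : MiddleStepFor fun X ↦ ChowRankLEOneUpTo X 0 := by
  obtain ⟨G, -⟩ := exists_gysinFormalism_isGysinHodgeCompatible_complexOrientation_holds
  exact middleStepFor_chowRankLEOne_of_gysin G

/-- **The Hodge conjecture is equivalent to the heart of the line** — HC in the middle degree for
CH₀-non-degenerate `2q`-folds given HC below (`q ≥ 2`) — by theorem, with no hypothesis left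
(`hodgeConjecture_iff_heart_of_gysin` over the now unconditional Gysin formalism).
[cite: VoisinHodgeII2003, Thm. 10.17 and Prop. 10.26] -/
theorem hodgeConjecture_iff_heart : _root_.HodgeConjecture ↔ MiddleStepFor fun X ↦ ¬ ChowZeroDegenerate X := by
  obtain ⟨G, hG⟩ := exists_gysinFormalism_isGysinHodgeCompatible_complexOrientation_holds
  exact hodgeConjecture_iff_heart_of_gysin G hG

/-- **The crux `VerticalSupportMiddle` is equivalent to the heart of the line**, unconditionally: the single
remaining registered stub `stub_middleStepHeartland` of the skeleton `Lines/regime_split_middle_step.lean` is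
exactly as strong as the crux (and as the Hodge conjecture). [cite: VoisinHodgeII2003, Thm. 10.17 and Prop. 10.26] -/
theorem verticalSupportMiddle_iff_heart :
    Summit.HodgeConjecture.HodgeConjecture.Theses.CurveNetMordellWeil.VerticalSupportMiddle ↔
      MiddleStepFor fun X ↦ ¬ ChowZeroDegenerate X :=
  verticalSupportMiddle_iff_hodgeConjecture.trans hodgeConjecture_iff_heart

end Summit.HodgeConjecture.HodgeConjecture.Theorems

end
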